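import Summits.CriticalPhenomena.PercolationContinuityZ3.Theorems.PercNearOneGluingNoHeavyQuantGluedTripleTrueFloor
import HarnessLib

/-!
# QUANT lane R8, T-DEC: towards the identical glued QUADRUPLE at its true floor — the basis expansion of four gated copies and the
# lift-free components `gate_m(ρ⁴)`, `gate_{4m/3}(ρ³)`, `gate_{2m}(ρ²)`, `t_m⁴ = t_m³ ∗ t_m`, `gate_m(ρ²) ∗ gate_m(ρ²)` (prim-quant-census-2 gen 80)

builds on p205010 (kernel theorem, internal audit signed; external expert review pending)

Support file (`--supports stmt-CriticalPhenomena-4575`), QUANT lane census seat prim-quant-census-2 (gen 80); memo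
`run/shared/lean/prim/quant/prim-quant-census-2-g80/TRIPLE-G80.md` §5.  Theorems only, standard axioms, no sorries, no definitions.

The width-4 analogue of `…QuantGluedTripleTrueFloor`: for an outer gate `a` (`m = aq`) the law `gate_a(t_q⁴)` is a convex combination of
  `gate_m(ρ⁴)`, `t_m⁴`, `gate_{4m/3}(ρ³)`, `gate_{2m}(ρ²)`                          (`m ≤ 1/2`),
  `gate_m(ρ⁴)`, `t_m⁴`, `gate_m(ρ²) ∗ gate_m(ρ²)`, `gate_{4m/3}(ρ³)`                  (`1/2 < m ≤ 3/4`),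
  `gate_m(ρ⁴)`, `t_m⁴`, `gate_m(ρ²) ∗ gate_m(ρ²)`, `ρ³ ∗ gate_{4m−3} ρ`               (`m > 3/4`)
(exact closed-form weights, next file).  This file certifies the LIFT-FREE components at floor `m·g`, target `4m(r+kg)`, every layer below `4(r+k)`:
gated blob laws (`decAtT_comp4_blob4`, `decAtT_comp4_blob3g`, `decAtT_comp4_blob2g`), the binomial `t_m³ ∗ t_m` by `ConvClosedT` from the WIDTH-3
THEOREM `sdec_gluedThree_trueFloor` and `sdec_gate` at their own means (`decAtT_comp4_binomial`), and the pair of gated sure pairs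
`gate_m(ρ²) ∗ gate_m(ρ²)` by `ConvClosedT` (`decAtT_comp4_pairpair`); plus the expansion `gatedQuadruple_expand` in the basis `δ₀, ρ, ρ², ρ³, ρ⁴`.
With these the quadruple is SDEC at its true floor for every `q ≤ 3/4` (no lift at all); `m > 3/4` needs the four-blob lift `ρ³ ∗ gate_c ρ`.

HONEST STATUS.  Components; `SiblingStep`, `FarTreeRow` OPEN; RATE class (log\*) / honest sentence of `run/shared/lean/prim/quant/README.md` unchanged.
[this work].  Nothing here is cited as a published result.  The gluing rows served [cite: KozmaNitzan2024, Conjecture 3 (p. 15)]; product measure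
[cite: Grimmett1999, §1.3 p. 10].
-/

noncomputable section

open scoped BigOperators

namespace Summit.CriticalPhenomena.PercolationContinuityZ3.Theorems
namespace Quant
namespace LawDec

open Finset

/-! ### Four gated copies in the basis `δ₀, ρ, ρ², ρ³, ρ⁴` -/

/-- linearity of `lconv` in the left factor, four terms. -/
theorem lconv_lin4_left (M₁ M₂ : ℕ) (a b d e : ℝ) (f g u v μ : ℕ → ℝ) (h : ℕ) :
    lconv M₁ M₂ (fun k => a * f k + b * g k + d * u k + e * v k) μ h =
      a * lconv M₁ M₂ f μ h + b * lconv M₁ M₂ g μ h + d * lconv M₁ M₂ u μ h + e * lconv M₁ M₂ v μ h := by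
  simp only [lconv, Finset.mul_sum, ← Finset.sum_add_distrib]
  refine Finset.sum_congr rfl fun i _ => Finset.sum_congr rfl fun k _ => ?_
  split_ifs <;> ring

/-- four gated copies of one law in the basis `ρ⁴, ρ³, ρ², ρ, δ₀` (`ρ²= ρ∗ρ`, `ρ³ = ρ²∗ρ`, `ρ⁴ = ρ³∗ρ`). [this work] -/
theorem gatedQuadruple_expand (M : ℕ) (ρ : ℕ → ℝ) (hρM : ∀ h, M < h → ρ h = 0) (c₁ c₂ c₃ c₄ : ℝ) (h : ℕ) :
    lconv (M + M + M) M (lconv (M + M) M (lconv M M (gate ρ c₁) (gate ρ c₂)) (gate ρ c₃)) (gate ρ c₄) h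
      = c₁ * c₂ * c₃ * c₄ * lconv (M + M + M) M (lconv (M + M) M (lconv M M ρ ρ) ρ) ρ h
        + (c₄ * (c₃ * (c₁ * (1 - c₂) + (1 - c₁) * c₂) + (1 - c₃) * (c₁ * c₂)) + (1 - c₄) * (c₁ * c₂ * c₃))
          * lconv (M + M) M (lconv M M ρ ρ) ρ h
        + (c₄ * (c₃ * ((1 - c₁) * (1 - c₂)) + (1 - c₃) * (c₁ * (1 - c₂) + (1 - c₁) * c₂))
            + (1 - c₄) * (c₃ * (c₁ * (1 - c₂) + (1 - c₁) * c₂) + (1 - c₃) * (c₁ * c₂))) * lconv M M ρ ρ h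
        + (c₄ * ((1 - c₃) * ((1 - c₁) * (1 - c₂)))
            + (1 - c₄) * (c₃ * ((1 - c₁) * (1 - c₂)) + (1 - c₃) * (c₁ * (1 - c₂) + (1 - c₁) * c₂))) * ρ h
        + (1 - c₄) * ((1 - c₃) * ((1 - c₁) * (1 - c₂))) * (if h = 0 then (1 : ℝ) else 0) := by
  have eT : lconv (M + M) M (lconv M M (gate ρ c₁) (gate ρ c₂)) (gate ρ c₃)
      = fun h => c₁ * c₂ * c₃ * lconv (M + M) M (lconv M M ρ ρ) ρ h
        + (c₃ * (c₁ * (1 - c₂) + (1 - c₁) * c₂) + (1 - c₃) * (c₁ * c₂)) * lconv M M ρ ρ h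
        + (c₃ * ((1 - c₁) * (1 - c₂)) + (1 - c₃) * (c₁ * (1 - c₂) + (1 - c₁) * c₂)) * ρ h
        + (1 - c₃) * ((1 - c₁) * (1 - c₂)) * (if h = 0 then (1 : ℝ) else 0) := funext (gatedTriple_expand M ρ hρM c₁ c₂ c₃)
  have h2M : ∀ t, M + M < t → lconv M M ρ ρ t = 0 := fun t ht => lconv_eq_zero M M ρ ρ t ht
  have h3M : ∀ t, M + M + M < t → lconv (M + M) M (lconv M M ρ ρ) ρ t = 0 := fun t ht => lconv_eq_zero _ _ _ _ t ht
  have hTM : ∀ t, M + M + M < t → (fun h => c₁ * c₂ * c₃ * lconv (M + M) M (lconv M M ρ ρ) ρ h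
        + (c₃ * (c₁ * (1 - c₂) + (1 - c₁) * c₂) + (1 - c₃) * (c₁ * c₂)) * lconv M M ρ ρ h
        + (c₃ * ((1 - c₁) * (1 - c₂)) + (1 - c₃) * (c₁ * (1 - c₂) + (1 - c₁) * c₂)) * ρ h
        + (1 - c₃) * ((1 - c₁) * (1 - c₂)) * (if h = 0 then (1 : ℝ) else 0)) t = 0 := fun t ht => by
    simp only [h3M t ht, h2M t (by omega), hρM t (by omega), if_neg (show t ≠ 0 by omega)]; ring
  rw [eT, lconv_gate_right (M + M + M) M _ ρ c₄ hTM h, lconv_lin4_left,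
    lconv_top_left_of_le (M + M) (M + M + M) M _ ρ (by omega) h2M h,
    lconv_top_left_of_le M (M + M + M) M ρ ρ (by omega) hρM h, lconv_delta_left (M + M + M) M ρ hρM h]
  ring

/-! ### `ρ⁴` -/

/-- `ρ⁴ = ρ³ ∗ ρ` is a blob law: laws, mean `4(r+kg)`, SDEC at `g`. [this work] -/
theorem glued_power4_facts (r k : ℕ) {g : ℝ} (hg0 : 0 < g) (hg1 : g < 1) :
    let ρ := blobLaw [(k, g), (r, 1)]
    let ρ3 := lconv ((r + k) + (r + k)) (r + k) (lconv (r + k) (r + k) ρ ρ) ρ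
    (∀ h, 0 ≤ lconv ((r + k) + (r + k) + (r + k)) (r + k) ρ3 ρ h) ∧
    (∀ h, (r + k) + (r + k) + (r + k) + (r + k) < h → lconv ((r + k) + (r + k) + (r + k)) (r + k) ρ3 ρ h = 0) ∧
    (∑ h ∈ Finset.range ((r + k) + (r + k) + (r + k) + (r + k) + 1), lconv ((r + k) + (r + k) + (r + k)) (r + k) ρ3 ρ h = 1) ∧
    (∑ h ∈ Finset.range ((r + k) + (r + k) + (r + k) + (r + k) + 1), (h : ℝ) * lconv ((r + k) + (r + k) + (r + k)) (r + k) ρ3 ρ h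
        = ((r : ℝ) + k * g) + ((r : ℝ) + k * g) + ((r : ℝ) + k * g) + ((r : ℝ) + k * g)) ∧
    SDEC g ((r + k) + (r + k) + (r + k) + (r + k)) (lconv ((r + k) + (r + k) + (r + k)) (r + k) ρ3 ρ) := by
  intro ρ ρ3
  obtain ⟨a0, aM, a1, amn⟩ := glued_blob_laws r k hg0.le hg1.le
  obtain ⟨-, -, -, -, -, c0, cM, c1, cmn, -⟩ := glued_powers_facts r k hg0 hg1
  obtain ⟨d0, dM, d1, dmn⟩ := lconv_laws c0 c1 cmn a0 a1 amn
  obtain ⟨hl2, hl3⟩ := glued_lists_gates r k hg1.le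
  have hL : ∀ p ∈ [((k : ℕ), g), (r, (1 : ℝ))], g ≤ p.2 ∧ p.2 ≤ 1 := fun p hp => hl2 p (List.mem_append.2 (Or.inl hp))
  have hl4 : ∀ p ∈ ([(k, g), (r, (1 : ℝ))] ++ ([(k, g), (r, 1)] ++ ([(k, g), (r, 1)] ++ [(k, g), (r, 1)]))), g ≤ p.2 ∧ p.2 ≤ 1 := by
    intro p hp
    rcases List.mem_append.1 hp with h | h
    · exact hL p h
    · exact hl3 p h
  have e2 : blobLaw ([(k, g), (r, (1 : ℝ))] ++ [(k, g), (r, 1)]) = lconv (r + k) (r + k) ρ ρ := by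
    rw [blobLaw_append, blobTop_glued]
  have t2 : blobTop ([(k, g), (r, (1 : ℝ))] ++ [(k, g), (r, 1)]) = (r + k) + (r + k) := by
    rw [blobTop_append, blobTop_glued]
  have e3 : blobLaw ([(k, g), (r, (1 : ℝ))] ++ ([(k, g), (r, 1)] ++ [(k, g), (r, 1)])) = ρ3 := by
    show _ = lconv ((r + k) + (r + k)) (r + k) (lconv (r + k) (r + k) ρ ρ) ρ
    rw [blobLaw_append, e2, t2, blobTop_glued]
  have t3 : blobTop ([(k, g), (r, (1 : ℝ))] ++ ([(k, g), (r, 1)] ++ [(k, g), (r, 1)])) = (r + k) + (r + k) + (r + k) := by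
    rw [blobTop_append, t2, blobTop_glued]
  have e4 : blobLaw ([(k, g), (r, (1 : ℝ))] ++ ([(k, g), (r, 1)] ++ ([(k, g), (r, 1)] ++ [(k, g), (r, 1)])))
      = lconv ((r + k) + (r + k) + (r + k)) (r + k) ρ3 ρ := by
    rw [blobLaw_append, e3, t3, blobTop_glued]
  have t4 : blobTop ([(k, g), (r, (1 : ℝ))] ++ ([(k, g), (r, 1)] ++ ([(k, g), (r, 1)] ++ [(k, g), (r, 1)])))
      = (r + k) + (r + k) + (r + k) + (r + k) := by
    rw [blobTop_append, t3, blobTop_glued]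
  have s4 := sdec_blobLaw g hg0 hg1 _ hl4
  rw [t4, e4] at s4
  exact ⟨d0, dM, d1, dmn, s4⟩

/-! ### The lift-free components at floor `m·g`, target `4m(r+kg)` -/

/-- **`gate_m(ρ⁴)`**, a gated blob law. [this work] -/
theorem decAtT_comp4_blob4 (r k : ℕ) {g m : ℝ} (hg0 : 0 < g) (hg1 : g < 1) (hm0 : 0 < m) (hm1 : m ≤ 1)
    (j : ℕ) (hj : j < (r + k) + (r + k) + (r + k) + (r + k)) :
    DECAtT (m * g) (4 * (m * ((r : ℝ) + k * g))) j ((r + k) + (r + k) + (r + k) + (r + k))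
      (gate (lconv ((r + k) + (r + k) + (r + k)) (r + k)
        (lconv ((r + k) + (r + k)) (r + k) (lconv (r + k) (r + k) (blobLaw [(k, g), (r, 1)]) (blobLaw [(k, g), (r, 1)]))
          (blobLaw [(k, g), (r, 1)])) (blobLaw [(k, g), (r, 1)])) m) := by
  obtain ⟨-, -, -, dmn, s4⟩ := glued_power4_facts r k hg0 hg1
  have d := s4 m hm0 hm1 j hj
  rw [decAt_iff_decAtT, sum_mul_gate, dmn] at d
  have e : m * (((r : ℝ) + k * g) + ((r : ℝ) + k * g) + ((r : ℝ) + k * g) + ((r : ℝ) + k * g)) = 4 * (m * ((r : ℝ) + k * g)) := by ring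
  rwa [e] at d

/-- **`gate_e(ρ³)` with `3e = 4m`, `e ≤ 1`** (via the floor `3g/4`). [this work] -/
theorem decAtT_comp4_blob3g (r k : ℕ) {g m e : ℝ} (hg0 : 0 < g) (hg1 : g < 1) (hm0 : 0 < m) (he : 3 * e = 4 * m) (he1 : e ≤ 1)
    (j : ℕ) :
    DECAtT (m * g) (4 * (m * ((r : ℝ) + k * g))) j ((r + k) + (r + k) + (r + k) + (r + k))
      (gate (lconv ((r + k) + (r + k)) (r + k) (lconv (r + k) (r + k) (blobLaw [(k, g), (r, 1)]) (blobLaw [(k, g), (r, 1)]))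
        (blobLaw [(k, g), (r, 1)])) e) := by
  obtain ⟨-, -, -, -, -, c0, cM, c1, cmn, s3⟩ := glued_powers_facts r k hg0 hg1
  have he0 : 0 < e := by linarith
  have hx0 : 0 < 3 * g / 4 := by positivity
  have s3' := sdec_mono s3 (by linarith : 3 * g / 4 ≤ g) hg1
  have hr0 : (0 : ℝ) ≤ r := Nat.cast_nonneg r
  have hk0 : (0 : ℝ) ≤ k := Nat.cast_nonneg k
  have d : DECAt (e * (3 * g / 4)) j ((r + k) + (r + k) + (r + k))
      (gate (lconv ((r + k) + (r + k)) (r + k) (lconv (r + k) (r + k) (blobLaw [(k, g), (r, 1)]) (blobLaw [(k, g), (r, 1)]))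
        (blobLaw [(k, g), (r, 1)])) e) := by
    by_cases hjM : j < (r + k) + (r + k) + (r + k)
    · exact s3' e he0 he1 j hjM
    · refine decAt_gate_of_top_le _ _ (3 * g / 4) e hx0.le (by nlinarith) he0.le he1 c0 cM c1 ?_ j (not_lt.1 hjM)
      rw [cmn]; push_cast; nlinarith
  rw [decAt_iff_decAtT, sum_mul_gate, cmn] at d
  have ef : e * (3 * g / 4) = m * g := by linear_combination (g / 4) * he
  have eT : e * (((r : ℝ) + k * g) + ((r : ℝ) + k * g) + ((r : ℝ) + k * g)) = 4 * (m * ((r : ℝ) + k * g)) := by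
    linear_combination ((r : ℝ) + k * g) * he
  rw [ef, eT] at d
  exact decAtT_mono_top d (by omega)

/-- **`gate_e(ρ²)` with `e = 2m ≤ 1`** (via the floor `g/2`). [this work] -/
theorem decAtT_comp4_blob2g (r k : ℕ) {g m e : ℝ} (hg0 : 0 < g) (hg1 : g < 1) (hm0 : 0 < m) (he : e = 2 * m) (he1 : e ≤ 1)
    (j : ℕ) :
    DECAtT (m * g) (4 * (m * ((r : ℝ) + k * g))) j ((r + k) + (r + k) + (r + k) + (r + k))
      (gate (lconv (r + k) (r + k) (blobLaw [(k, g), (r, 1)]) (blobLaw [(k, g), (r, 1)])) e) := by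
  obtain ⟨b0, bM, b1, bmn, s2, -⟩ := glued_powers_facts r k hg0 hg1
  have he0 : 0 < e := by linarith
  have hx0 : 0 < g / 2 := by positivity
  have s2' := sdec_mono s2 (by linarith : g / 2 ≤ g) hg1
  have hr0 : (0 : ℝ) ≤ r := Nat.cast_nonneg r
  have hk0 : (0 : ℝ) ≤ k := Nat.cast_nonneg k
  have d : DECAt (e * (g / 2)) j ((r + k) + (r + k))
      (gate (lconv (r + k) (r + k) (blobLaw [(k, g), (r, 1)]) (blobLaw [(k, g), (r, 1)])) e) := by
    by_cases hjM : j < (r + k) + (r + k)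
    · exact s2' e he0 he1 j hjM
    · refine decAt_gate_of_top_le _ _ (g / 2) e hx0.le (by nlinarith) he0.le he1 b0 bM b1 ?_ j (not_lt.1 hjM)
      rw [bmn]; push_cast; nlinarith
  rw [decAt_iff_decAtT, sum_mul_gate, bmn] at d
  have ef : e * (g / 2) = m * g := by rw [he]; ring
  have eT : e * (((r : ℝ) + k * g) + ((r : ℝ) + k * g)) = 4 * (m * ((r : ℝ) + k * g)) := by rw [he]; ring
  rw [ef, eT] at d
  exact decAtT_mono_top d (by omega)

/-- **`t_m⁴ = t_m³ ∗ t_m`** (`0 < m < 1`): `ConvClosedT` from the WIDTH-3 THEOREM and the single sibling at their own means. [this work] -/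
theorem decAtT_comp4_binomial (r k : ℕ) {g m : ℝ} (hg0 : 0 < g) (hg1 : g < 1) (hm0 : 0 < m) (hm1 : m < 1)
    (j : ℕ) (hj : j < (r + k) + (r + k) + (r + k) + (r + k)) :
    DECAtT (m * g) (4 * (m * ((r : ℝ) + k * g))) j ((r + k) + (r + k) + (r + k) + (r + k))
      (lconv ((r + k) + (r + k) + (r + k)) (r + k)
        (lconv ((r + k) + (r + k)) (r + k)
          (lconv (r + k) (r + k) (gate (blobLaw [(k, g), (r, 1)]) m) (gate (blobLaw [(k, g), (r, 1)]) m))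
          (gate (blobLaw [(k, g), (r, 1)]) m))
        (gate (blobLaw [(k, g), (r, 1)]) m)) := by
  obtain ⟨a0, aM, a1, amn⟩ := glued_blob_laws r k hg0.le hg1.le
  obtain ⟨u0, uM, u1⟩ := gate_laws (r + k) _ m hm0.le hm1.le a0 aM a1
  have umn : ∑ h ∈ Finset.range (r + k + 1), (h : ℝ) * gate (blobLaw [(k, g), (r, 1)]) m h = m * ((r : ℝ) + k * g) := by
    rw [sum_mul_gate, amn]
  obtain ⟨p0, pM, p1, pmn⟩ := lconv_laws u0 u1 umn u0 u1 umn
  obtain ⟨t0, tM, t1, tmn⟩ := lconv_laws p0 p1 pmn u0 u1 umn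
  have hx0 : 0 < m * g := mul_pos hm0 hg0
  have hx1 : m * g < 1 := by nlinarith
  have hr0 : (0 : ℝ) ≤ r := Nat.cast_nonneg r
  have hk0 : (0 : ℝ) ≤ k := Nat.cast_nonneg k
  -- the single sibling
  have hρS : SDEC g (r + k) (blobLaw [(k, g), (r, 1)]) := by
    have h := sdec_blobLaw g hg0 hg1 [((k : ℕ), g), (r, (1 : ℝ))] (fun p hp => by
      simp only [List.mem_cons, List.mem_nil_iff, or_false] at hp
      rcases hp with rfl | rfl
      · exact ⟨le_rfl, hg1.le⟩
      · exact ⟨hg1.le, le_rfl⟩)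
    rwa [blobTop_glued] at h
  have d₂ : ∀ j'', DECAtT (m * g) (m * ((r : ℝ) + k * g)) j'' (r + k) (gate (blobLaw [(k, g), (r, 1)]) m) := by
    intro j''
    have d : DECAt (m * g) j'' (r + k) (gate (blobLaw [(k, g), (r, 1)]) m) := by
      by_cases hjM : j'' < r + k
      · have h := sdec_gate hρS m hm0 hm1.le 1 one_pos le_rfl j'' hjM
        rwa [gate_one, one_mul] at h
      · exact decAt_gate_of_top_le (r + k) _ g m hg0.le hx1 hm0.le hm1.le a0 aM a1 (by rw [amn]; push_cast; nlinarith) j''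
          (not_lt.1 hjM)
    rwa [decAt_iff_decAtT, sum_mul_gate, amn] at d
  -- the triple at its true floor (width-3 theorem)
  have htri := sdec_gluedThree_trueFloor r k hm0 hm1 hg0 hg1
  have d₁ : ∀ j'', DECAtT (m * g) (m * ((r : ℝ) + k * g) + m * ((r : ℝ) + k * g) + m * ((r : ℝ) + k * g)) j''
      ((r + k) + (r + k) + (r + k))
      (lconv ((r + k) + (r + k)) (r + k)
        (lconv (r + k) (r + k) (gate (blobLaw [(k, g), (r, 1)]) m) (gate (blobLaw [(k, g), (r, 1)]) m))
        (gate (blobLaw [(k, g), (r, 1)]) m)) := by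
    intro j''
    have d : DECAt (m * g) j'' ((r + k) + (r + k) + (r + k))
        (lconv ((r + k) + (r + k)) (r + k)
          (lconv (r + k) (r + k) (gate (blobLaw [(k, g), (r, 1)]) m) (gate (blobLaw [(k, g), (r, 1)]) m))
          (gate (blobLaw [(k, g), (r, 1)]) m)) := by
      by_cases hjM : j'' < (r + k) + (r + k) + (r + k)
      · have h := htri 1 one_pos le_rfl j'' hjM
        rwa [gate_one, one_mul] at h
      · refine decAt_of_top_le _ _ t0 tM t1 (m * g) hx1 (fun h hh => ?_) j'' (not_lt.1 hjM)
        have hhM : h ≤ (r + k) + (r + k) + (r + k) := by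
          by_contra hc
          exact absurd (tM h (not_le.1 hc)) hh.ne'
        have this : (h : ℝ) ≤ (((r + k) + (r + k) + (r + k) : ℕ) : ℝ) := by exact_mod_cast hhM
        rw [tmn]
        push_cast at this
        have h1 : m * g * (h : ℝ) ≤ m * g * (((r : ℝ) + k) + ((r : ℝ) + k) + ((r : ℝ) + k)) := mul_le_mul_of_nonneg_left this hx0.le
        have h2 : m * (g * (r : ℝ)) ≤ m * r := mul_le_mul_of_nonneg_left (mul_le_of_le_one_left hr0 hg1.le) hm0.le
        linarith
    rwa [decAt_iff_decAtT, tmn] at d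
  have hC := convClosedT_holds (m * g) _ _ ((r + k) + (r + k) + (r + k)) (r + k) j _ _ hx0 hx1 t0 tM t1 u0 uM u1 hj
    (fun j'' _ _ => d₁ j'') (fun j'' _ _ => d₂ j'')
  have e : m * ((r : ℝ) + k * g) + m * ((r : ℝ) + k * g) + m * ((r : ℝ) + k * g) + m * ((r : ℝ) + k * g)
      = 4 * (m * ((r : ℝ) + k * g)) := by ring
  rwa [e] at hC

/-- **`gate_m(ρ²) ∗ gate_m(ρ²)`** (`0 < m ≤ 1`): `ConvClosedT` from two gated blob laws at their own means. [this work] -/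
theorem decAtT_comp4_pairpair (r k : ℕ) {g m : ℝ} (hg0 : 0 < g) (hg1 : g < 1) (hm0 : 0 < m) (hm1 : m ≤ 1)
    (j : ℕ) (hj : j < (r + k) + (r + k) + (r + k) + (r + k)) :
    DECAtT (m * g) (4 * (m * ((r : ℝ) + k * g))) j ((r + k) + (r + k) + (r + k) + (r + k))
      (lconv ((r + k) + (r + k)) ((r + k) + (r + k))
        (gate (lconv (r + k) (r + k) (blobLaw [(k, g), (r, 1)]) (blobLaw [(k, g), (r, 1)])) m)
        (gate (lconv (r + k) (r + k) (blobLaw [(k, g), (r, 1)]) (blobLaw [(k, g), (r, 1)])) m)) := by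
  obtain ⟨b0, bM, b1, bmn, s2, -⟩ := glued_powers_facts r k hg0 hg1
  obtain ⟨v0, vM, v1⟩ := gate_laws ((r + k) + (r + k)) _ m hm0.le hm1 b0 bM b1
  have hx0 : 0 < m * g := mul_pos hm0 hg0
  have hx1 : m * g < 1 := by nlinarith
  have hr0 : (0 : ℝ) ≤ r := Nat.cast_nonneg r
  have hk0 : (0 : ℝ) ≤ k := Nat.cast_nonneg k
  have d₁ : ∀ j'', DECAtT (m * g) (m * (((r : ℝ) + k * g) + ((r : ℝ) + k * g))) j'' ((r + k) + (r + k))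
      (gate (lconv (r + k) (r + k) (blobLaw [(k, g), (r, 1)]) (blobLaw [(k, g), (r, 1)])) m) := by
    intro j''
    have d : DECAt (m * g) j'' ((r + k) + (r + k)) (gate (lconv (r + k) (r + k) (blobLaw [(k, g), (r, 1)]) (blobLaw [(k, g), (r, 1)])) m) := by
      by_cases hjM : j'' < (r + k) + (r + k)
      · have h := sdec_gate s2 m hm0 hm1 1 one_pos le_rfl j'' hjM
        rwa [gate_one, one_mul] at h
      · exact decAt_gate_of_top_le _ _ g m hg0.le hx1 hm0.le hm1 b0 bM b1 (by rw [bmn]; push_cast; nlinarith) j'' (not_lt.1 hjM)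
    rwa [decAt_iff_decAtT, sum_mul_gate, bmn] at d
  have hj' : j < (r + k) + (r + k) + ((r + k) + (r + k)) := by omega
  have hC := convClosedT_holds (m * g) _ _ ((r + k) + (r + k)) ((r + k) + (r + k)) j _ _ hx0 hx1 v0 vM v1 v0 vM v1 hj'
    (fun j'' _ _ => d₁ j'') (fun j'' _ _ => d₁ j'')
  have e : m * (((r : ℝ) + k * g) + ((r : ℝ) + k * g)) + m * (((r : ℝ) + k * g) + ((r : ℝ) + k * g)) = 4 * (m * ((r : ℝ) + k * g)) := by
    ring
  rw [e] at hC
  exact decAtT_mono_top hC (by omega)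

end LawDec
end Quant
end Summit.CriticalPhenomena.PercolationContinuityZ3.Theorems
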